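import Mathlib
import HarnessLib
import Summits.NavierStokesRegularity.NavierStokesRegularity.Theorems.AxisTwistDoorAveragedConeLiouvilleDefs

/-!
# Route `AxisTwistDoor`, crux `AveragedConeLiouville` (stmt-NavierStokesRegularity-26889), line `lrt_shell`, stub (5)
# `stub_fluxDecay` — brick F1: the SCALE ITERATION (Lei–Ren–Tian arXiv:2501.08976, §4 p. 12, eqs. Gamma-sigma-iter ff.)

The purely real-variable end of LRT's flux-decay argument, isolated so that the analytic heart of stub (5) only has to
produce the ONE-SCALE CONTRACTION.  For the axis circulation `Γ = circ v` of any profile `v`: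

* `FluxDecay v` says `sup_{𝒬(ρ)} Γ → 0` as `ρ → 0`, where `𝒬(ρ) = {−ρ² < s < 0, 0 < r < ρ, |z| < ρ}`.
* If flux decay FAILS there is a level `κ₀ > 0` met in every `𝒬(ρ)` (`exists_level_of_not_fluxDecay`).
* **Iteration** (`fluxDecay_of_scale_contraction`): suppose that for every such level `κ₀ > 0` the non-decay hypothesis
  yields a bound `Γ ≤ Γ*` on `𝒬(9/10)` and a contraction factor `0 < σ ≤ 1` such that at EVERY scale `0 < ρ ≤ 1` a bound
  `Γ ≤ M` on `𝒬(9ρ/10)` improves to `Γ ≤ (1 − σ) M` on `𝒬(9ρ/20)` (this is what LRT prove at scale `1` by the shell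
  mechanism and transport to scale `ρ` by the Navier–Stokes rescaling `v ↦ ρ v(ρ² s, ρ y)`, eq. Gamma-sigma-iter); then
  iterating `m` times gives `Γ ≤ (1−σ)^m Γ*` on `𝒬((9/10) 2^{−m})`, which falls below `κ₀` — contradiction. Hence
  `FluxDecay v`.

Seat ns-atd-p1 (LEAD). WHAT THIS IS NOT: not a statement about Navier–Stokes regularity; real-variable bookkeeping
for a STAGED door route; the analytic contraction (stub (5) proper) is NOT proved here. Lands `--supports` the crux
item as a helper.
-/

noncomputable section

-- the summit and its single sub-problem share the name (CONVENTIONS §1), as in every Theorems file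
set_option linter.dupNamespace false

namespace Summit.NavierStokesRegularity.NavierStokesRegularity.Theorems.AxisTwistDoorAveragedConeLiouvilleFluxIteration

open Set
open Summit.NavierStokesRegularity.NavierStokesRegularity.Theorems.AxisTwistDoorAveragedConeLiouvilleDefs

variable (v : ℝ → EuclideanSpace ℝ (Fin 3) → EuclideanSpace ℝ (Fin 3))

/-- A bound `M` for the axis circulation on the parabolic cylinder `𝒬(ρ) = {−ρ² < s < 0, 0 < r < ρ, |z| < ρ}`. -/
def CircBoundOn (ρ M : ℝ) : Prop :=
  ∀ s r z : ℝ, -ρ ^ 2 < s → s < 0 → 0 < r → r < ρ → |z| < ρ → circ v r z s ≤ M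

/-- `CircBoundOn` is monotone in the cylinder: a bound on `𝒬(ρ')` is a bound on `𝒬(ρ)` for `ρ ≤ ρ'`. -/
theorem circBoundOn_mono {ρ ρ' M : ℝ} (hρ : 0 ≤ ρ) (h : ρ ≤ ρ') (hb : CircBoundOn v ρ' M) : CircBoundOn v ρ M := by
  intro s r z hs hs0 hr hrρ hz
  have hρρ : ρ ^ 2 ≤ ρ' ^ 2 := pow_le_pow_left₀ hρ h 2
  exact hb s r z (by linarith) hs0 hr (lt_of_lt_of_le hrρ h) (lt_of_lt_of_le hz h)

/-- If flux decay fails, some level `κ₀ > 0` is met in every cylinder `𝒬(ρ)`. -/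
theorem exists_level_of_not_fluxDecay (h : ¬ FluxDecay v) :
    ∃ κ₀ : ℝ, 0 < κ₀ ∧ ∀ ρ : ℝ, 0 < ρ →
      ∃ s r z : ℝ, -ρ ^ 2 < s ∧ s < 0 ∧ 0 < r ∧ r < ρ ∧ |z| < ρ ∧ κ₀ ≤ circ v r z s := by
  unfold FluxDecay at h
  push Not at h
  obtain ⟨κ₀, hκ₀, hall⟩ := h
  refine ⟨κ₀, hκ₀, fun ρ hρ => ?_⟩
  obtain ⟨s, r, z, hs, hs0, hr, hrρ, hz, hge⟩ := hall ρ hρ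
  exact ⟨s, r, z, hs, hs0, hr, hrρ, hz, hge⟩

/-- The `m`-fold iterate of the one-scale contraction: `Γ ≤ (1−σ)^m Γ*` on `𝒬((9/10)·2^{−m})`. -/
theorem circBoundOn_iterate {σ Γstar : ℝ} (h0 : CircBoundOn v (9 / 10) Γstar)
    (hstep : ∀ ρ : ℝ, 0 < ρ → ρ ≤ 1 → ∀ M : ℝ, CircBoundOn v (9 * ρ / 10) M → CircBoundOn v (9 * ρ / 20) ((1 - σ) * M)) :
    ∀ m : ℕ, CircBoundOn v (9 / 10 * (1 / 2) ^ m) ((1 - σ) ^ m * Γstar) := by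
  intro m
  induction m with
  | zero => simpa using h0
  | succ m ih =>
    have hρ : (0 : ℝ) < (1 / 2) ^ m := by positivity
    have hρ1 : ((1 : ℝ) / 2) ^ m ≤ 1 := pow_le_one₀ (by norm_num) (by norm_num)
    have h := hstep ((1 / 2) ^ m) hρ hρ1 ((1 - σ) ^ m * Γstar) (by
      have e : 9 * ((1 : ℝ) / 2) ^ m / 10 = 9 / 10 * (1 / 2) ^ m := by ring
      rw [e]; exact ih)
    have e1 : 9 * ((1 : ℝ) / 2) ^ m / 20 = 9 / 10 * (1 / 2) ^ (m + 1) := by rw [pow_succ]; ring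
    have e2 : (1 - σ) * ((1 - σ) ^ m * Γstar) = (1 - σ) ^ (m + 1) * Γstar := by rw [pow_succ]; ring
    rw [e1, e2] at h
    exact h

/-- **Brick F1 — flux decay from the one-scale contraction at every scale** (LRT §4, p. 12: "Iterating
(Gamma-sigma-iter), we deduce … which contradicts (kappa)"). If every non-decay level `κ₀ > 0` produces a bound
`Γ ≤ Γ*` on `𝒬(9/10)` together with a contraction factor `σ ∈ (0, 1]` valid at every scale `ρ ∈ (0, 1]`, then the
axis circulation decays at the apex. -/
theorem fluxDecay_of_scale_contraction
    (h : ∀ κ₀ : ℝ, 0 < κ₀ →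
      (∀ ρ : ℝ, 0 < ρ → ∃ s r z : ℝ, -ρ ^ 2 < s ∧ s < 0 ∧ 0 < r ∧ r < ρ ∧ |z| < ρ ∧ κ₀ ≤ circ v r z s) →
      ∃ σ Γstar : ℝ, 0 < σ ∧ σ ≤ 1 ∧ CircBoundOn v (9 / 10) Γstar ∧
        ∀ ρ : ℝ, 0 < ρ → ρ ≤ 1 → ∀ M : ℝ,
          CircBoundOn v (9 * ρ / 10) M → CircBoundOn v (9 * ρ / 20) ((1 - σ) * M)) :
    FluxDecay v := by
  by_contra hnot
  obtain ⟨κ₀, hκ₀, hlev⟩ := exists_level_of_not_fluxDecay v hnot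
  obtain ⟨σ, Γstar, hσ, hσ1, h0, hstep⟩ := h κ₀ hκ₀ hlev
  -- `Γ* ≥ κ₀ > 0` (the level is met inside `𝒬(9/10)`)
  have hΓ : κ₀ ≤ Γstar := by
    obtain ⟨s, r, z, hs, hs0, hr, hrρ, hz, hge⟩ := hlev (9 / 10) (by norm_num)
    exact hge.trans (h0 s r z hs hs0 hr hrρ hz)
  -- choose `m` with `(1 − σ)^m Γ* < κ₀`
  have hq0 : 0 ≤ 1 - σ := by linarith
  have hq1 : 1 - σ < 1 := by linarith
  obtain ⟨m, hm⟩ : ∃ m : ℕ, (1 - σ) ^ m * Γstar < κ₀ := by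
    have hΓpos : 0 < Γstar := lt_of_lt_of_le hκ₀ hΓ
    obtain ⟨m, hm⟩ := exists_pow_lt_of_lt_one (div_pos hκ₀ hΓpos) hq1
    exact ⟨m, by rwa [lt_div_iff₀ hΓpos] at hm⟩
  have hiter := circBoundOn_iterate v h0 hstep m
  have hρ : (0 : ℝ) < 9 / 10 * (1 / 2) ^ m := by positivity
  obtain ⟨s, r, z, hs, hs0, hr, hrρ, hz, hge⟩ := hlev _ hρ
  have := hiter s r z hs hs0 hr hrρ hz
  linarith

end Summit.NavierStokesRegularity.NavierStokesRegularity.Theorems.AxisTwistDoorAveragedConeLiouvilleFluxIteration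

end
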